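import Literature.NumberTheory.GaloisCohomology.PoitouTateSelmerCountProofs
import HarnessLib

/-!
# Crux V2♭θ `KolyvaginCorankLowerBoundAtTwoTheta` (stmt-BirchSwinnertonDyer-27220), line
# `kolyvagin_depth_split`, inside of S1, piece **P5** (auxiliary class with size) — ABSTRACT PART:
# a `τ`-stable isotropic subgroup of Lagrangian size in a `τ`-invariant perfect pairing space at `2`
# has balanced eigen-parts — I: the counting lemmas (helper, PROVED; seat `bsd-line-krr2-p2` g7)

Setting (the local cohomology `H = H¹(K_{v₀}, E[2^M])` at the Kolyvagin prime `v₀` being swapped out,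
with `b(x, y) = ⟨x, w_v y⟩_{v₀}` the local Tate pairing composed with the Weil transport, `τ` the action of
complex conjugation, `K = Kum_{v₀}` the Kummer (unramified) condition, `A = loc_{v₀} H¹_{𝓕(m)^{v₀}}(K, E[2^M])`
the image of the Selmer group relaxed at `v₀`): `H` a finite abelian group killed by `2^M`,
`b : H × H → ℤ/2^M` bi-additive and PERFECT (both adjoints bijective) and `τ`-INVARIANT, `τ² = 1`,
`K ≤ H` `τ`-stable and SELF-ANNIHILATING (`K = K^⊥`, Kummer self-duality), `#K = 2^{2M}`,
`#K[2^e] ≤ 2^{2e}` (`K ≅ E[2^M]`) and the LINE STRUCTURE of its eigen-parts `#(K^ε ∩ K[2^e]) ≤ 2^{e+1}`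
(brick B at `2` from Zhang's numerics, this seat's `kummer_eigen_at_two_of_index`); `A ≤ H` `τ`-stable,
isotropic, with `#H ≤ #A²` (Poitou–Tate at one place).  CONCLUSION (`exists_eigen_pow_smul_ne_zero_of_isotropic`, in the sequel `…LagrangianSign.lean`):
for `s = ±1` some `a ∈ A` has `τ a = s a` and `2^{⌊(M-7)/2⌋} a ≠ 0`.  This file: the counting lemmas.

Mechanism (no structure of the transverse condition is used): for `ε = ±1` the subgroup
`R_ε = (τ − ε)K ≤ K^{−ε}` is orthogonal to the whole eigenspace `H^ε` (`b(τk − εk, x) = 0` when `τx = εx`,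
by invariance and `τ² = 1`) and meets `H^ε` inside `K[2]`; so for `T ≤ H^ε` and `D₀ ≤ K` with `T ⊥ D₀`,
`T + K ≤ (R_ε + D₀)^⊥` and the annihilator count (`natCard_annihilator_mul_natCard`, `#K² = #H`) gives
`#T · #(R_ε + D₀) ≤ #K · #(T ∩ K)` (`card_mul_card_sup_le`).  With `T = A^{−s}`, `D₀ = A^{−s} ∩ K`:
`#A^{−s} ≤ #K^{−s} · #K[2] ≤ 2^{M+3}`; `(1 + sτ)A ≤ A^s` with kernel `A^{−s}` gives `#A^s ≥ 2^{M−3}`; and if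
`2^e A^s = 0`, `T = A^s`, `D₀ = 2^e K` gives `#A^s ≤ 2^{2e+3}`.  Kolyvagin's signed count at an odd prime
(Jetchev 2008 Lemma 5.2, the tree's `Walk.natCard_map_localization_signPart_relaxedAt`) divides by `2`;
this is its substitute at `p = 2`, losing `O(1)` bits.
HONEST FRAMING: helper (`--supports` 27220), pure group theory; the instantiation at `v₀` and the global
count are separate files; S1 / V2♭θ are NOT proved; BSD is not proved by any of this.

References: [cite: Kolyvagin1991MathAnn, §2 (proof of Thm. 2.2, the auxiliary class)]
[cite: Jetchev2008, Lemma 5.2 and §3.2 (2)] [cite: McCallumLMS1991, §5 Prop. 5.2]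
[cite: MilneADT2006, Ch. I §0 Prop. 0.19 (finite duality)].
-/

set_option autoImplicit false
-- the Theorems namespace of this sub repeats the summit name by design (D-0017 nested layout)
set_option linter.dupNamespace false

namespace Summit.BirchSwinnertonDyer.BirchSwinnertonDyer.Theorems.KolyvaginLowerBoundAtTwo.LagrangianSign

open Function Literature.NumberTheory.GaloisCohomology

variable {H : Type*} [AddCommGroup H]

/-! ### Counting helpers -/

/-- `#(T ⊔ K) · #(T ⊓ K) = #T · #K` for subgroups of a finite abelian group (second isomorphism
theorem, as cardinalities). [folklore] -/
theorem card_sup_mul_card_inf [Finite H] (T K : AddSubgroup H) :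
    Nat.card (T ⊔ K : AddSubgroup H) * Nat.card (T ⊓ K : AddSubgroup H) = Nat.card T * Nat.card K := by
  classical
  -- `[T ⊔ K : K] = [T : T ⊓ K]`
  have h1 : K.relIndex (T ⊔ K) = K.relIndex T := AddSubgroup.relIndex_sup_right T K
  -- `[L : K] · #K = #L` for `K ≤ L`
  have h2 : K.relIndex (T ⊔ K) * Nat.card K = Nat.card (T ⊔ K : AddSubgroup H) := by
    rw [AddSubgroup.relIndex, ← Nat.card_congr (AddSubgroup.addSubgroupOfEquivOfLe
      (le_sup_right : K ≤ T ⊔ K)).toEquiv]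
    exact (K.addSubgroupOf (T ⊔ K)).index_mul_card
  have h3 : K.relIndex T * Nat.card (T ⊓ K : AddSubgroup H) = Nat.card T := by
    rw [AddSubgroup.relIndex]
    have e : (K.addSubgroupOf T) ≃ (T ⊓ K : AddSubgroup H) :=
      { toFun := fun x => ⟨(x.1 : H), ⟨x.1.2, x.2⟩⟩
        invFun := fun y => ⟨⟨y.1, y.2.1⟩, y.2.2⟩
        left_inv := fun x => rfl
        right_inv := fun y => rfl }
    rw [← Nat.card_congr e]
    exact (K.addSubgroupOf T).index_mul_card
  calc Nat.card (T ⊔ K : AddSubgroup H) * Nat.card (T ⊓ K : AddSubgroup H)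
      = K.relIndex (T ⊔ K) * Nat.card K * Nat.card (T ⊓ K : AddSubgroup H) := by rw [h2]
    _ = K.relIndex T * Nat.card (T ⊓ K : AddSubgroup H) * Nat.card K := by rw [h1]; ring
    _ = Nat.card T * Nat.card K := by rw [h3]

/-- `#f(S) · #(S ∩ ker f) = #S` for an endomorphism `f` and a subgroup `S` (first isomorphism theorem
for `f|_S`). [folklore] -/
theorem card_map_mul_card_inf_ker [Finite H] (f : H →+ H) (S : AddSubgroup H) :
    Nat.card (S.map f) * Nat.card (S ⊓ f.ker : AddSubgroup H) = Nat.card S := by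
  classical
  set g : S →+ H := f.comp S.subtype with hg
  have hrange : g.range = S.map f := by
    rw [hg, AddMonoidHom.range_comp, AddSubgroup.range_subtype]
  have hker : Nat.card g.ker = Nat.card (S ⊓ f.ker : AddSubgroup H) := by
    exact Nat.card_congr
      { toFun := fun x => ⟨(x.1 : H), AddSubgroup.mem_inf.mpr ⟨x.1.2,
          (AddMonoidHom.mem_ker (f := f)).mpr ((AddMonoidHom.mem_ker (f := g)).mp x.2)⟩⟩
        invFun := fun y => ⟨⟨y.1, (AddSubgroup.mem_inf.mp y.2).1⟩,
          (AddMonoidHom.mem_ker (f := g)).mpr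
            ((AddMonoidHom.mem_ker (f := f)).mp (AddSubgroup.mem_inf.mp y.2).2)⟩
        left_inv := fun x => rfl
        right_inv := fun y => rfl }
  rw [← hrange, ← hker, ← Nat.card_congr (QuotientAddGroup.quotientKerEquivRange g).toEquiv]
  exact (g.ker.card_eq_card_quotient_mul_card_addSubgroup).symm

/-- **Eigen-lines at `2`: from "order `≤ 2^{M+1}` with an element of order `2^M`" to the torsion bounds
`#(S ∩ H[2^e]) ≤ 2^{e+1}`** (`S ⊇ ℤg ≅ ℤ/2^M` of index `≤ 2`).  Converts the shape of this seat's
`kummer_eigen_at_two_of_index` into the hypothesis `hKline` of `exists_eigen_pow_smul_ne_zero_of_isotropic`.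
[cite: Jetchev2008, §3.2 (2)] -/
theorem card_inf_torsion_le_of_line [Finite H] {M : ℕ} (S : AddSubgroup H) (hS : Nat.card S ≤ 2 ^ (M + 1))
    {g : H} (hg : g ∈ S) (hgM : (2 : ℤ) ^ M • g = 0) (hg1 : (2 : ℤ) ^ (M - 1) • g ≠ 0) (hM : 1 ≤ M)
    (e : ℕ) : Nat.card (S ⊓ ((2 : ℤ) ^ e • AddMonoidHom.id H).ker : AddSubgroup H) ≤ 2 ^ (e + 1) := by
  classical
  set T : AddSubgroup H := S ⊓ ((2 : ℤ) ^ e • AddMonoidHom.id H).ker with hT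
  rcases le_or_gt M e with hMe | heM
  · -- trivial range
    calc Nat.card T ≤ Nat.card S := Nat.card_le_card_of_injective _ (AddSubgroup.inclusion_injective inf_le_left)
      _ ≤ 2 ^ (M + 1) := hS
      _ ≤ 2 ^ (e + 1) := Nat.pow_le_pow_right (by norm_num) (by omega)
  -- the line `C = ℤ g` of order `2^M`
  set C : AddSubgroup H := AddSubgroup.zmultiples g with hC
  have hzs : ∀ (n : ℕ) (x : H), (2 : ℤ) ^ n • x = (2 ^ n) • x := fun n x => by
    rw [← natCast_zsmul, Nat.cast_pow, Nat.cast_ofNat]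
  have hordg : addOrderOf g = 2 ^ M := by
    have h := addOrderOf_eq_prime_pow (p := 2) (n := M - 1) (x := g)
      (by rw [← hzs]; exact hg1) (by rw [show M - 1 + 1 = M by omega, ← hzs]; exact hgM)
    rwa [show M - 1 + 1 = M by omega] at h
  have hCcard : Nat.card C = 2 ^ M := by rw [hC, Nat.card_zmultiples, hordg]
  -- `#(C ∩ H[2^e]) ≤ 2^e`: the multiples of `2^e g` have order `2^(M-e)`
  have hCtor : Nat.card (C ⊓ ((2 : ℤ) ^ e • AddMonoidHom.id H).ker : AddSubgroup H) ≤ 2 ^ e := by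
    have hsplit := card_map_mul_card_inf_ker ((2 : ℤ) ^ e • AddMonoidHom.id H) C
    have hord' : addOrderOf ((2 : ℤ) ^ e • g) = 2 ^ (M - e) := by
      have h := addOrderOf_eq_prime_pow (p := 2) (n := M - e - 1) (x := (2 : ℤ) ^ e • g)
        (by
          rw [← hzs, smul_smul, ← pow_add, show M - e - 1 + e = M - 1 by omega]; exact hg1)
        (by
          rw [show M - e - 1 + 1 = M - e by omega, ← hzs, smul_smul, ← pow_add,
            show M - e + e = M by omega]; exact hgM)
      rwa [show M - e - 1 + 1 = M - e by omega] at h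
    have hle : AddSubgroup.zmultiples ((2 : ℤ) ^ e • g) ≤ C.map ((2 : ℤ) ^ e • AddMonoidHom.id H) := by
      rw [AddSubgroup.zmultiples_le]
      exact ⟨g, AddSubgroup.mem_zmultiples g, rfl⟩
    have hmap : 2 ^ (M - e) ≤ Nat.card (C.map ((2 : ℤ) ^ e • AddMonoidHom.id H)) := by
      calc 2 ^ (M - e) = Nat.card (AddSubgroup.zmultiples ((2 : ℤ) ^ e • g)) := by
            rw [Nat.card_zmultiples, hord']
        _ ≤ _ := Nat.card_le_card_of_injective _ (AddSubgroup.inclusion_injective hle)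
    have h1 : 2 ^ (M - e) * Nat.card (C ⊓ ((2 : ℤ) ^ e • AddMonoidHom.id H).ker : AddSubgroup H) ≤
        2 ^ e * 2 ^ (M - e) := by
      calc 2 ^ (M - e) * Nat.card (C ⊓ ((2 : ℤ) ^ e • AddMonoidHom.id H).ker : AddSubgroup H)
          ≤ Nat.card (C.map ((2 : ℤ) ^ e • AddMonoidHom.id H)) *
              Nat.card (C ⊓ ((2 : ℤ) ^ e • AddMonoidHom.id H).ker : AddSubgroup H) :=
            Nat.mul_le_mul_right _ hmap
        _ = 2 ^ M := by rw [hsplit, hCcard]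
        _ = 2 ^ e * 2 ^ (M - e) := by rw [← pow_add]; congr 1; omega
    rw [mul_comm] at h1
    exact Nat.le_of_mul_le_mul_right h1 (by positivity)
  -- `#(T ⊔ C) ≤ #S`, `#(T ⊓ C) ≤ 2^e`, `#(T ⊔ C) · #(T ⊓ C) = #T · #C`
  have hsup := card_sup_mul_card_inf T C
  have hTC : (T ⊔ C : AddSubgroup H) ≤ S :=
    sup_le inf_le_left ((AddSubgroup.zmultiples_le).mpr hg)
  have hTCi : (T ⊓ C : AddSubgroup H) ≤ C ⊓ ((2 : ℤ) ^ e • AddMonoidHom.id H).ker := fun x hx =>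
    AddSubgroup.mem_inf.mpr ⟨(AddSubgroup.mem_inf.mp hx).2,
      (AddSubgroup.mem_inf.mp (AddSubgroup.mem_inf.mp hx).1).2⟩
  have h2 : Nat.card T * 2 ^ M ≤ 2 ^ (e + 1) * 2 ^ M := by
    calc Nat.card T * 2 ^ M = Nat.card T * Nat.card C := by rw [hCcard]
      _ = Nat.card (T ⊔ C : AddSubgroup H) * Nat.card (T ⊓ C : AddSubgroup H) := hsup.symm
      _ ≤ Nat.card S * Nat.card (C ⊓ ((2 : ℤ) ^ e • AddMonoidHom.id H).ker : AddSubgroup H) :=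
          Nat.mul_le_mul (Nat.card_le_card_of_injective _ (AddSubgroup.inclusion_injective hTC))
            (Nat.card_le_card_of_injective _ (AddSubgroup.inclusion_injective hTCi))
      _ ≤ 2 ^ (M + 1) * 2 ^ e := Nat.mul_le_mul hS hCtor
      _ = 2 ^ (e + 1) * 2 ^ M := by rw [← pow_add, ← pow_add]; congr 1; omega
  exact Nat.le_of_mul_le_mul_right h2 (by positivity)

section Pairing

variable [Finite H] {M : ℕ} (hH : ∀ x : H, (2 ^ M) • x = 0)
  (b : H →+ H →+ ZMod (2 ^ M)) (hb' : Bijective b.flip)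
  (τ : H →+ H) (hτ : ∀ x, τ (τ x) = x) (hbτ : ∀ x y, b (τ x) (τ y) = b x y)
  (K : AddSubgroup H) (hKτ : ∀ x ∈ K, τ x ∈ K) (hK : ∀ x, x ∈ K ↔ ∀ y ∈ K, b y x = 0)

/-! ### The annihilator count -/

include hH hb' in
/-- **`#D^⊥ · #D = #H`** for the right annihilator `D^⊥ = {y : b(d, y) = 0 ∀ d ∈ D}` of a subgroup `D`
under a pairing with bijective right adjoint (Milne ADT I.0.19, through the tree's
`natCard_annihilator_mul_natCard`). [cite: MilneADT2006, Ch. I §0 Prop. 0.19] -/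
theorem card_annihilator_mul_card (D : AddSubgroup H) :
    Nat.card (⨅ d : D, (b (d : H)).ker : AddSubgroup H) * Nat.card D = Nat.card H := by
  haveI : NeZero (2 ^ M) := ⟨pow_ne_zero M two_ne_zero⟩
  refine natCard_annihilator_mul_natCard hH b.flip hb' D _ fun a => ?_
  rw [AddSubgroup.mem_iInf]
  constructor
  · intro h x hx
    rw [AddMonoidHom.flip_apply]
    exact (AddMonoidHom.mem_ker).mp (h ⟨x, hx⟩)
  · intro h x
    exact (AddMonoidHom.mem_ker).mpr (by rw [← AddMonoidHom.flip_apply]; exact h x x.2)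

include hH hb' hK in
/-- **`#K · #K = #H`** for a self-annihilating `K` (`K = K^⊥`: the Kummer condition is its own
orthogonal complement, Tate local duality). [cite: MilneADT2006, Ch. I §0 Prop. 0.19 and Ch. I §3 Thm. 3.2] -/
theorem card_mul_card_eq_of_selfAnnihilating : Nat.card K * Nat.card K = Nat.card H := by
  haveI : NeZero (2 ^ M) := ⟨pow_ne_zero M two_ne_zero⟩
  refine natCard_annihilator_mul_natCard hH b.flip hb' K K fun a => ?_
  rw [hK a]
  simp only [AddMonoidHom.flip_apply]

/-! ### The eigenspaces of `τ` against `(τ − ε)K` -/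

omit [Finite H] in
include hτ hbτ in
/-- **`(τ − ε)K ⊥ H^ε`**: `b(τk − εk, x) = 0` whenever `τx = εx` (invariance and `τ² = 1`:
`b(τk, x) = b(k, τx) = ε b(k, x)`). [cite: Kolyvagin1991MathAnn, §2] -/
theorem pairing_sub_smul_eq_zero_of_eigen (ε : ℤ) {x : H} (hx : τ x = ε • x) (k : H) :
    b ((τ - ε • AddMonoidHom.id H) k) x = 0 := by
  have h1 : b (τ k) x = ε • b k x := by
    conv_lhs => rw [← hτ x]
    rw [hbτ, hx, map_zsmul]
  rw [AddMonoidHom.sub_apply, AddMonoidHom.smul_apply, AddMonoidHom.id_apply, map_sub,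
    AddMonoidHom.sub_apply, map_zsmul, AddMonoidHom.smul_apply, h1, sub_self]

omit [Finite H] in
include hτ in
/-- **`(τ − ε)K ∩ H^ε ⊆ H[2]`** for `ε = ±1`: if `y = τk − εk` and `τy = εy` then `2y = 0`. [folklore] -/
theorem two_smul_eq_zero_of_eigen_of_eq_sub (ε : ℤ) (hε : ε = 1 ∨ ε = -1) {k y : H}
    (hy : y = (τ - ε • AddMonoidHom.id H) k) (hτy : τ y = ε • y) : (2 : ℤ) • y = 0 := by
  have hε2 : ε * ε = 1 := by rcases hε with rfl | rfl <;> norm_num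
  rw [AddMonoidHom.sub_apply, AddMonoidHom.smul_apply, AddMonoidHom.id_apply] at hy
  subst hy
  rw [map_sub, map_zsmul, hτ] at hτy
  -- `k − ε τk = ε τk − ε² k`
  have h2 : (2 : ℤ) • k = (2 * ε) • τ k := by
    rw [smul_sub, smul_smul, hε2, one_smul] at hτy
    have : k + k = ε • τ k + ε • τ k := by
      calc k + k = (k - ε • τ k) + ε • τ k + k := by abel
        _ = (ε • τ k - k) + ε • τ k + k := by rw [hτy]
        _ = ε • τ k + ε • τ k := by abel
    rw [two_smul, this, mul_smul, two_smul]
  calc (2 : ℤ) • (τ k - ε • k) = (2 : ℤ) • τ k - ε • ((2 : ℤ) • k) := by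
        rw [smul_sub, smul_comm]
    _ = (2 : ℤ) • τ k - ε • ((2 * ε) • τ k) := by rw [h2]
    _ = 0 := by rw [smul_smul, ← mul_assoc, mul_comm ε 2, mul_assoc, hε2, mul_one, sub_self]

omit [Finite H] in
include hτ in
/-- **`(τ − ε)K ⊆ H^{−ε}`** for `ε = ±1`: `τ(τk − εk) = −ε(τk − εk)`. [folklore] -/
theorem tau_sub_smul_eq_neg (ε : ℤ) (hε : ε = 1 ∨ ε = -1) (k : H) :
    τ ((τ - ε • AddMonoidHom.id H) k) = (-ε) • (τ - ε • AddMonoidHom.id H) k := by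
  have hε2 : ε * ε = 1 := by rcases hε with rfl | rfl <;> norm_num
  rw [AddMonoidHom.sub_apply, AddMonoidHom.smul_apply, AddMonoidHom.id_apply, map_sub, map_zsmul, hτ,
    smul_sub, smul_smul, neg_mul, hε2]
  module

/-! ### The key count -/

include hH hb' hτ hbτ hKτ hK in
/-- **The key count.** For `T ≤ H^ε` and `D₀ ≤ K` with `b(D₀, T) = 0`:
`#T · #((τ − ε)K + D₀) ≤ #K · #(T ∩ K)` — since `T + K ≤ ((τ − ε)K + D₀)^⊥` (`(τ − ε)K ⊥ H^ε`, `K = K^⊥`)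
and `#D^⊥ · #D = #H = #K²`. [cite: MilneADT2006, Ch. I §0 Prop. 0.19] [cite: Jetchev2008, Lemma 5.2] -/
theorem card_mul_card_sup_le (ε : ℤ) (T : AddSubgroup H) (hT : ∀ x ∈ T, τ x = ε • x)
    (D₀ : AddSubgroup H) (hD₀ : D₀ ≤ K) (hTD : ∀ d ∈ D₀, ∀ x ∈ T, b d x = 0) :
    Nat.card T * Nat.card (K.map (τ - ε • AddMonoidHom.id H) ⊔ D₀ : AddSubgroup H) ≤
      Nat.card K * Nat.card (T ⊓ K : AddSubgroup H) := by
  classical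
  set D : AddSubgroup H := K.map (τ - ε • AddMonoidHom.id H) ⊔ D₀ with hDdef
  set Dp : AddSubgroup H := ⨅ d : D, (b (d : H)).ker with hDp
  have hmemDp : ∀ y, y ∈ Dp ↔ ∀ d ∈ D, b d y = 0 := fun y => by
    rw [hDp, AddSubgroup.mem_iInf]
    exact ⟨fun h d hd => (AddMonoidHom.mem_ker).mp (h ⟨d, hd⟩),
      fun h d => (AddMonoidHom.mem_ker).mpr (h d d.2)⟩
  -- `D ≤ K`
  have hDK : D ≤ K := by
    refine sup_le ?_ hD₀
    rintro _ ⟨k, hk, rfl⟩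
    rw [AddMonoidHom.sub_apply, AddMonoidHom.smul_apply, AddMonoidHom.id_apply]
    exact K.sub_mem (hKτ k hk) (K.zsmul_mem hk ε)
  -- `T ≤ D^⊥` and `K ≤ D^⊥`
  have hTDp : T ≤ Dp := fun y hy => by
    rw [hmemDp]
    intro d hd
    have hsub : D ≤ (b.flip y).ker := by
      refine sup_le ?_ fun d hd => ?_
      · rintro _ ⟨k, -, rfl⟩
        rw [AddMonoidHom.mem_ker, AddMonoidHom.flip_apply]
        exact pairing_sub_smul_eq_zero_of_eigen b τ hτ hbτ ε (hT y hy) k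
      · rw [AddMonoidHom.mem_ker, AddMonoidHom.flip_apply]
        exact hTD d hd y hy
    have := hsub hd
    rwa [AddMonoidHom.mem_ker, AddMonoidHom.flip_apply] at this
  have hKDp : K ≤ Dp := fun y hy => by
    rw [hmemDp]
    exact fun d hd => ((hK y).mp hy) d (hDK hd)
  have hle : (T ⊔ K : AddSubgroup H) ≤ Dp := sup_le hTDp hKDp
  -- counts
  have h1 : Nat.card (T ⊔ K : AddSubgroup H) ≤ Nat.card Dp :=
    Nat.card_le_card_of_injective _ (AddSubgroup.inclusion_injective hle)
  have h2 : Nat.card Dp * Nat.card D = Nat.card H := card_annihilator_mul_card hH b hb' D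
  have h3 : Nat.card K * Nat.card K = Nat.card H := card_mul_card_eq_of_selfAnnihilating hH b hb' K hK
  have h4 := card_sup_mul_card_inf T K
  -- `#T · #K · #D = #(T ⊔ K) · #(T ⊓ K) · #D ≤ #Dp · #D · #(T ⊓ K) = #K² · #(T ⊓ K)`
  have hKpos : 0 < Nat.card K := Nat.card_pos
  have key : Nat.card T * Nat.card D * Nat.card K ≤ Nat.card K * Nat.card (T ⊓ K : AddSubgroup H) * Nat.card K := by
    calc Nat.card T * Nat.card D * Nat.card K
        = Nat.card (T ⊔ K : AddSubgroup H) * Nat.card (T ⊓ K : AddSubgroup H) * Nat.card D := by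
          rw [mul_right_comm, h4]
      _ ≤ Nat.card Dp * Nat.card (T ⊓ K : AddSubgroup H) * Nat.card D := by
          gcongr
      _ = Nat.card Dp * Nat.card D * Nat.card (T ⊓ K : AddSubgroup H) := by ring
      _ = Nat.card K * Nat.card (T ⊓ K : AddSubgroup H) * Nat.card K := by rw [h2, ← h3]; ring
  exact Nat.le_of_mul_le_mul_right key hKpos


/-! ### Isotropic subgroups of an eigenspace are small -/

include hH hb' hτ hbτ hKτ hK in
/-- **An isotropic subgroup of `H^ε` has at most `#K^ε · #K[2]` elements** (`ε = ±1`): the key count with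
`T = B`, `D₀ = B ∩ K`, and `(τ − ε)K ∩ B ⊆ K[2]`, `#(τ − ε)K · #K^ε = #K`.  (At an odd prime the same
argument gives `#B ≤ #K^ε`: Jetchev's Lemma 5.2.) [cite: Jetchev2008, Lemma 5.2] [cite: Kolyvagin1991MathAnn, §2] -/
theorem card_isotropic_eigen_le (ε : ℤ) (hε : ε = 1 ∨ ε = -1) (B : AddSubgroup H)
    (hB : ∀ x ∈ B, τ x = ε • x) (hBB : ∀ x ∈ B, ∀ y ∈ B, b x y = 0) :
    Nat.card B ≤ Nat.card (K ⊓ (τ - ε • AddMonoidHom.id H).ker : AddSubgroup H) *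
      Nat.card (K ⊓ ((2 : ℤ) • AddMonoidHom.id H).ker : AddSubgroup H) := by
  classical
  set R : AddSubgroup H := K.map (τ - ε • AddMonoidHom.id H) with hR
  set D₀ : AddSubgroup H := B ⊓ K with hD₀
  -- the key count
  have hkey := card_mul_card_sup_le hH b hb' τ hτ hbτ K hKτ hK ε B hB D₀ inf_le_right
    (fun d hd x hx => hBB d (AddSubgroup.mem_inf.mp hd).1 x hx)
  -- `#(R ⊔ D₀) · #(R ⊓ D₀) = #R · #D₀`
  have hsup := card_sup_mul_card_inf R D₀
  -- `R ⊓ D₀ ≤ K ∩ H[2]`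
  have hRD : (R ⊓ D₀ : AddSubgroup H) ≤ K ⊓ ((2 : ℤ) • AddMonoidHom.id H).ker := by
    intro x hx
    obtain ⟨hxR, hxD⟩ := AddSubgroup.mem_inf.mp hx
    obtain ⟨k, -, hk⟩ := AddSubgroup.mem_map.mp hxR
    refine AddSubgroup.mem_inf.mpr ⟨(AddSubgroup.mem_inf.mp hxD).2, ?_⟩
    rw [AddMonoidHom.mem_ker, AddMonoidHom.smul_apply, AddMonoidHom.id_apply]
    exact two_smul_eq_zero_of_eigen_of_eq_sub τ hτ ε hε hk.symm (hB x (AddSubgroup.mem_inf.mp hxD).1)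
  have hRDcard : Nat.card (R ⊓ D₀ : AddSubgroup H) ≤
      Nat.card (K ⊓ ((2 : ℤ) • AddMonoidHom.id H).ker : AddSubgroup H) :=
    Nat.card_le_card_of_injective _ (AddSubgroup.inclusion_injective hRD)
  -- `#R · #K^ε = #K`
  have hRK : Nat.card R * Nat.card (K ⊓ (τ - ε • AddMonoidHom.id H).ker : AddSubgroup H) = Nat.card K :=
    card_map_mul_card_inf_ker _ K
  -- combine
  have hRpos : 0 < Nat.card R := Nat.card_pos
  have hDpos : 0 < Nat.card D₀ := Nat.card_pos
  have h1 : Nat.card B * (Nat.card R * Nat.card D₀) ≤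
      Nat.card K * Nat.card D₀ * Nat.card (K ⊓ ((2 : ℤ) • AddMonoidHom.id H).ker : AddSubgroup H) := by
    calc Nat.card B * (Nat.card R * Nat.card D₀)
        = Nat.card B * Nat.card (R ⊔ D₀ : AddSubgroup H) * Nat.card (R ⊓ D₀ : AddSubgroup H) := by
          rw [← hsup]; ring
      _ ≤ Nat.card K * Nat.card (B ⊓ K : AddSubgroup H) * Nat.card (R ⊓ D₀ : AddSubgroup H) :=
          Nat.mul_le_mul_right _ hkey
      _ ≤ Nat.card K * Nat.card D₀ * Nat.card (K ⊓ ((2 : ℤ) • AddMonoidHom.id H).ker : AddSubgroup H) :=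
          Nat.mul_le_mul_left _ hRDcard
  rw [← hRK] at h1
  have h2 : Nat.card B * (Nat.card R * Nat.card D₀) ≤
      (Nat.card (K ⊓ (τ - ε • AddMonoidHom.id H).ker : AddSubgroup H) *
        Nat.card (K ⊓ ((2 : ℤ) • AddMonoidHom.id H).ker : AddSubgroup H)) * (Nat.card R * Nat.card D₀) := by
    calc Nat.card B * (Nat.card R * Nat.card D₀)
        ≤ Nat.card R * Nat.card (K ⊓ (τ - ε • AddMonoidHom.id H).ker : AddSubgroup H) * Nat.card D₀ *
            Nat.card (K ⊓ ((2 : ℤ) • AddMonoidHom.id H).ker : AddSubgroup H) := h1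
      _ = _ := by ring
  exact Nat.le_of_mul_le_mul_right h2 (Nat.mul_pos hRpos hDpos)

end Pairing

end Summit.BirchSwinnertonDyer.BirchSwinnertonDyer.Theorems.KolyvaginLowerBoundAtTwo.LagrangianSign
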